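import Mathlib.Analysis.SpecialFunctions.ImproperIntegrals
import Mathlib.Analysis.SpecialFunctions.Integrals.Basic
import Literature.Analysis.FunctionSpaces.TorusThetaBound
import Literature.Analysis.FunctionSpaces.TorusInverseLaplacian
import Literature.Analysis.FluidPDE.FractionalNSTorus
import HarnessLib

/-!
# FunctionalMining — lattice counting on `ℤ³` in the spectral weights `σ_t(k) = (4π²|k|²)^t`

Search for candidate a priori estimates; no regularity claim. Cell `pub-nsfunc`, prove seat
(gen 12). First file of the lattice trilinear estimate behind the static half of the rows
`EF.s | T_LD | G1` (`HsProductionBound`, file `HsSaturatingLawReduction`). With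
`μ_q = 4π²|q|² = fracSymbol 1 q` (the Laplacian eigenvalues of the unit torus) we prove, on a
three-dimensional lattice `ℤ^d` (`card d = 3`):

* the **counting bound** `#{q ≠ 0 : μ_q ≤ c} ≤ K c^{3/2}` for all `c > 0`
  (`tsum_indicator_one_le`), read off the heat trace: `1 ≤ e · e^{-μ_q/c}` on the set, and
  `∑_{q ≠ 0} e^{-μ_q/c} ≤ C₀ c^{3/2}` (`Torus.tsum_heatCoeff_sub_one_le_rpow`);
* the **truncated Riesz sums** `∑_{q ≠ 0, μ_q ≤ c} μ_q^{-t} ≤ K c^{3/2 - t}` for every `t < 3/2` and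
  `c > 0` (`tsum_indicator_fracSymbol_le`): for `t ≤ 0` termwise from the counting bound, for
  `0 < t < 3/2` by the layer-cake formula `μ^{-t} = ∫_μ^∞ t s^{-t-1} ds`, Tonelli, and the counting
  bound at height `min(c, s)`.

Everything is stated with `ℝ≥0∞`-valued sums of `Set.indicator`s (unconditional convergence, no
decidability bookkeeping). Lattice-point counting is folklore (Landau); the heat-trace route avoids
any geometry of numbers.
-/

noncomputable section

open MeasureTheory Set Filter Topology Real
open scoped ENNReal NNReal

namespace Summit.NavierStokesRegularity.FunctionalMining

namespace LatticeTrilinear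

open Literature.Analysis.FunctionSpaces.Torus Literature.Analysis.FluidPDE.Torus

variable {d : Type*} [Fintype d]

/-! ## 1. The eigenvalue weights `μ_q = σ_1(q)` and `σ_t = μ^t` -/

/-- `σ_t(q) = μ_q^t` with `μ_q = σ_1(q)`. [folklore] -/
theorem fracSymbol_eq_rpow (t : ℝ) (q : d → ℤ) : fracSymbol t q = fracSymbol 1 q ^ t := by
  rw [fracSymbol_one]; rfl

/-- Off the origin `μ_q ≥ 1` (indeed `≥ 4π²`). [folklore] -/
theorem one_le_fracSymbol_one {q : d → ℤ} (hq : q ≠ 0) : 1 ≤ fracSymbol 1 q := by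
  rw [fracSymbol_one]
  have h1 := one_le_freqNormSq_of_ne_zero hq
  have hπ : (1 : ℝ) ≤ 4 * π ^ 2 := by nlinarith [Real.two_le_pi]
  nlinarith

/-- Off the origin `μ_q > 0`. [folklore] -/
theorem fracSymbol_one_pos {q : d → ℤ} (hq : q ≠ 0) : 0 < fracSymbol 1 q :=
  lt_of_lt_of_le one_pos (one_le_fracSymbol_one hq)

/-- `σ_{t+t'}(q) = σ_t(q) σ_{t'}(q)` off the origin. [folklore] -/
theorem fracSymbol_add_of_ne_zero {q : d → ℤ} (hq : q ≠ 0) (t t' : ℝ) :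
    fracSymbol (t + t') q = fracSymbol t q * fracSymbol t' q := by
  rw [fracSymbol_eq_rpow (t + t'), fracSymbol_eq_rpow t, fracSymbol_eq_rpow t',
    Real.rpow_add (fracSymbol_one_pos hq)]

/-- The heat coefficient at time `c⁻¹` is `e^{-μ_q/c}`. [folklore] -/
theorem heatCoeff_inv_eq (c : ℝ) (q : d → ℤ) : heatCoeff c⁻¹ q = Real.exp (-(fracSymbol 1 q * c⁻¹)) := by
  rw [heatCoeff_apply, fracSymbol_one]

/-! ## 2. The heat trace without its zero mode, in `ℝ≥0∞` -/

/-- `∑_{q ≠ 0} e^{-μ_q s} = Θ(s) − 1` as an `ℝ≥0∞` identity (`s > 0`). [folklore] -/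
theorem tsum_ite_ofReal_heatCoeff [DecidableEq (d → ℤ)] {s : ℝ} (hs : 0 < s) :
    ∑' q : d → ℤ, (if q = 0 then (0 : ℝ≥0∞) else ENNReal.ofReal (heatCoeff s q)) =
      ENNReal.ofReal ((∑' q : d → ℤ, heatCoeff s q) - 1) := by
  have hsumm := summable_heatCoeff (d := d) hs
  have hX : ENNReal.ofReal (∑' k : d → ℤ, heatCoeff s k) =
      1 + ∑' k : d → ℤ, (if k = 0 then (0 : ℝ≥0∞) else ENNReal.ofReal (heatCoeff s k)) := by
    rw [ENNReal.ofReal_tsum_of_nonneg (fun k => (heatCoeff_pos s k).le) hsumm,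
      ENNReal.tsum_eq_add_tsum_ite (f := fun k : d → ℤ => ENNReal.ofReal (heatCoeff s k)) 0,
      heatCoeff_zero_right, ENNReal.ofReal_one]
    congr 1
    exact tsum_congr fun k => by split_ifs <;> rfl
  rw [ENNReal.ofReal_sub _ zero_le_one, ENNReal.ofReal_one, hX, ENNReal.add_sub_cancel_left
    ENNReal.one_ne_top]

/-- **Heat-trace tail bound in `ℝ≥0∞` on `ℤ³`**: `∑_{q ≠ 0} e^{-μ_q s} ≤ C₀ s^{-3/2}`. [folklore] -/
theorem exists_tsum_ite_heatCoeff_le (hd : Fintype.card d = 3) :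
    ∃ C₀ : ℝ, 0 ≤ C₀ ∧ ∀ [DecidableEq (d → ℤ)] (s : ℝ), 0 < s →
      ∑' q : d → ℤ, (if q = 0 then (0 : ℝ≥0∞) else ENNReal.ofReal (heatCoeff s q)) ≤
        ENNReal.ofReal (C₀ * s ^ (-(3 / 2 : ℝ))) := by
  obtain ⟨C₀, hC₀, hΘ⟩ := tsum_heatCoeff_sub_one_le_rpow (d := d)
  rw [hd] at hΘ
  refine ⟨C₀, hC₀, fun s hs => ?_⟩
  rw [tsum_ite_ofReal_heatCoeff hs]
  refine ENNReal.ofReal_le_ofReal ?_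
  have h := hΘ s hs
  norm_num at h ⊢
  exact h

/-! ## 3. Counting lattice points below a level -/

/-- **Counting bound**: on `ℤ³` there is `K ≥ 0` with `#{q ≠ 0 : μ_q ≤ c} ≤ K c^{3/2}` for every
`c > 0` (as an `ℝ≥0∞` sum of an indicator). Proof: on the set, `1 ≤ e · e^{-μ_q/c}`; sum the heat
trace at time `1/c`. [folklore; Landau's lattice-point count, heat-trace proof] -/
theorem tsum_indicator_one_le (hd : Fintype.card d = 3) :
    ∃ K : ℝ, 0 ≤ K ∧ ∀ c : ℝ, 0 < c →
      ∑' q : d → ℤ, ({q : d → ℤ | q ≠ 0 ∧ fracSymbol 1 q ≤ c}).indicator (fun _ => (1 : ℝ≥0∞)) q ≤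
        ENNReal.ofReal (K * c ^ (3 / 2 : ℝ)) := by
  classical
  obtain ⟨C₀, hC₀, hΘ⟩ := exists_tsum_ite_heatCoeff_le hd
  refine ⟨Real.exp 1 * C₀, by positivity, fun c hc => ?_⟩
  have hpt : ∀ q : d → ℤ, ({q : d → ℤ | q ≠ 0 ∧ fracSymbol 1 q ≤ c}).indicator (fun _ => (1 : ℝ≥0∞)) q ≤
      ENNReal.ofReal (Real.exp 1) * (if q = 0 then (0 : ℝ≥0∞) else ENNReal.ofReal (heatCoeff c⁻¹ q)) := by
    intro q
    by_cases hq : q ∈ {q : d → ℤ | q ≠ 0 ∧ fracSymbol 1 q ≤ c}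
    · rw [indicator_of_mem hq, if_neg hq.1, ← ENNReal.ofReal_mul (Real.exp_pos 1).le,
        ← ENNReal.ofReal_one]
      refine ENNReal.ofReal_le_ofReal ?_
      rw [heatCoeff_inv_eq, ← Real.exp_add]
      have hle : fracSymbol 1 q * c⁻¹ ≤ 1 := by
        rw [← div_eq_mul_inv, div_le_one hc]; exact hq.2
      calc (1 : ℝ) = Real.exp 0 := (Real.exp_zero).symm
        _ ≤ Real.exp (1 + -(fracSymbol 1 q * c⁻¹)) := Real.exp_le_exp.2 (by linarith)
    · rw [indicator_of_notMem hq]; exact zero_le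
  calc ∑' q : d → ℤ, ({q : d → ℤ | q ≠ 0 ∧ fracSymbol 1 q ≤ c}).indicator (fun _ => (1 : ℝ≥0∞)) q
      ≤ ∑' q : d → ℤ, ENNReal.ofReal (Real.exp 1) *
          (if q = 0 then (0 : ℝ≥0∞) else ENNReal.ofReal (heatCoeff c⁻¹ q)) := ENNReal.tsum_le_tsum hpt
    _ = ENNReal.ofReal (Real.exp 1) *
          ∑' q : d → ℤ, (if q = 0 then (0 : ℝ≥0∞) else ENNReal.ofReal (heatCoeff c⁻¹ q)) :=
        ENNReal.tsum_mul_left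
    _ ≤ ENNReal.ofReal (Real.exp 1) * ENNReal.ofReal (C₀ * c⁻¹ ^ (-(3 / 2 : ℝ))) :=
        mul_le_mul' le_rfl (hΘ c⁻¹ (inv_pos.2 hc))
    _ = ENNReal.ofReal (Real.exp 1 * C₀ * c ^ (3 / 2 : ℝ)) := by
        rw [← ENNReal.ofReal_mul (Real.exp_pos 1).le, Real.inv_rpow hc.le, Real.rpow_neg hc.le, inv_inv]
        ring_nf

/-! ## 4. Truncated Riesz sums `∑_{q ≠ 0, μ_q ≤ c} μ_q^{-t}` -/

/-- `∫_μ^∞ t s^{-t-1} ds = μ^{-t}` as a Lebesgue integral of `ofReal` (`μ, t > 0`). [folklore] -/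
theorem lintegral_Ioi_mul_rpow_neg {t μ : ℝ} (ht : 0 < t) (hμ : 0 < μ) :
    ∫⁻ s in Ioi μ, ENNReal.ofReal (t * s ^ (-t - 1)) = ENNReal.ofReal (μ ^ (-t)) := by
  have hr : (-t - 1) < -1 := by linarith
  have hint : IntegrableOn (fun s : ℝ => t * s ^ (-t - 1)) (Ioi μ) volume :=
    (integrableOn_Ioi_rpow_of_lt hr hμ).const_mul t
  have hnn : 0 ≤ᵐ[volume.restrict (Ioi μ)] fun s : ℝ => t * s ^ (-t - 1) := by
    filter_upwards [ae_restrict_mem measurableSet_Ioi] with s hs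
    exact mul_nonneg ht.le (Real.rpow_nonneg (hμ.le.trans (le_of_lt hs)) _)
  rw [← ofReal_integral_eq_lintegral_ofReal hint hnn, integral_const_mul, integral_Ioi_rpow_of_lt hr hμ]
  congr 1
  rw [show (-t - 1 + 1) = -t by ring]
  field_simp

/-- `∫₀^{c} s^{1/2 - t} ds = c^{3/2 - t}/(3/2 - t)` as a Lebesgue integral of `ofReal` (`t < 3/2`,
`c > 0`). [folklore] -/
theorem lintegral_Ioc_rpow_half_sub {t c : ℝ} (ht : t < 3 / 2) (hc : 0 < c) :
    ∫⁻ s in Ioc (0 : ℝ) c, ENNReal.ofReal (s ^ (1 / 2 - t)) =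
      ENNReal.ofReal (c ^ (3 / 2 - t) / (3 / 2 - t)) := by
  have hr : (-1 : ℝ) < 1 / 2 - t := by linarith
  have hint : IntegrableOn (fun s : ℝ => s ^ (1 / 2 - t)) (Ioc 0 c) volume :=
    (intervalIntegrable_iff_integrableOn_Ioc_of_le hc.le).1
      (intervalIntegral.intervalIntegrable_rpow' hr)
  have hnn : 0 ≤ᵐ[volume.restrict (Ioc (0 : ℝ) c)] fun s : ℝ => s ^ (1 / 2 - t) := by
    filter_upwards [ae_restrict_mem measurableSet_Ioc] with s hs
    exact Real.rpow_nonneg hs.1.le _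
  rw [← ofReal_integral_eq_lintegral_ofReal hint hnn, ← intervalIntegral.integral_of_le hc.le,
    integral_rpow (Or.inl hr)]
  congr 1
  rw [show (1 / 2 - t + 1) = 3 / 2 - t by ring, Real.zero_rpow (by linarith), sub_zero]

/-- **Truncated Riesz sums on `ℤ³`**: for every `t < 3/2` there is `K ≥ 0` with
`∑_{q ≠ 0, μ_q ≤ c} μ_q^{-t} ≤ K c^{3/2 - t}` for all `c > 0` (`μ_q = 4π²|q|²`, `μ_q^{-t} = σ_{-t}(q)`;
as an `ℝ≥0∞` sum of an indicator). For `t ≤ 0` termwise `μ_q^{-t} ≤ c^{-t}` and the counting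
bound; for `0 < t < 3/2` the layer-cake formula `μ^{-t} = ∫_μ^∞ t s^{-t-1} ds`, Tonelli, and the
counting bound at height `min(c, s)`. [folklore] -/
theorem tsum_indicator_fracSymbol_le (hd : Fintype.card d = 3) {t : ℝ} (ht : t < 3 / 2) :
    ∃ K : ℝ, 0 ≤ K ∧ ∀ c : ℝ, 0 < c →
      ∑' q : d → ℤ, ({q : d → ℤ | q ≠ 0 ∧ fracSymbol 1 q ≤ c}).indicator
          (fun q => ENNReal.ofReal (fracSymbol (-t) q)) q ≤
        ENNReal.ofReal (K * c ^ (3 / 2 - t)) := by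
  classical
  obtain ⟨K₀, hK₀, hN⟩ := tsum_indicator_one_le hd
  rcases le_or_gt t 0 with ht0 | ht0
  · -- ### `t ≤ 0`: termwise
    refine ⟨K₀, hK₀, fun c hc => ?_⟩
    set S : Set (d → ℤ) := {q : d → ℤ | q ≠ 0 ∧ fracSymbol 1 q ≤ c} with hS
    have hpt : ∀ q, S.indicator (fun q => ENNReal.ofReal (fracSymbol (-t) q)) q ≤
        ENNReal.ofReal (c ^ (-t)) * S.indicator (fun _ => (1 : ℝ≥0∞)) q := by
      intro q
      by_cases hq : q ∈ S
      · rw [indicator_of_mem hq, indicator_of_mem hq, mul_one]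
        refine ENNReal.ofReal_le_ofReal ?_
        rw [fracSymbol_eq_rpow]
        exact Real.rpow_le_rpow (fracSymbol_nonneg 1 q) hq.2 (by linarith)
      · rw [indicator_of_notMem hq]; exact zero_le
    calc ∑' q, S.indicator (fun q => ENNReal.ofReal (fracSymbol (-t) q)) q
        ≤ ∑' q, ENNReal.ofReal (c ^ (-t)) * S.indicator (fun _ => (1 : ℝ≥0∞)) q := ENNReal.tsum_le_tsum hpt
      _ = ENNReal.ofReal (c ^ (-t)) * ∑' q, S.indicator (fun _ => (1 : ℝ≥0∞)) q := ENNReal.tsum_mul_left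
      _ ≤ ENNReal.ofReal (c ^ (-t)) * ENNReal.ofReal (K₀ * c ^ (3 / 2 : ℝ)) :=
          mul_le_mul' le_rfl (hN c hc)
      _ = ENNReal.ofReal (K₀ * c ^ (3 / 2 - t)) := by
          rw [← ENNReal.ofReal_mul (Real.rpow_nonneg hc.le _), sub_eq_add_neg, Real.rpow_add hc]
          ring_nf
  · -- ### `0 < t < 3/2`: layer cake
    have h32 : 0 < 3 / 2 - t := by linarith
    refine ⟨K₀ * (t / (3 / 2 - t) + 1), by positivity, fun c hc => ?_⟩
    set S : Set (d → ℤ) := {q : d → ℤ | q ≠ 0 ∧ fracSymbol 1 q ≤ c} with hS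
    set g : ℝ → ℝ≥0∞ := fun s => ENNReal.ofReal (t * s ^ (-t - 1)) with hg
    have hgm : Measurable g :=
      (measurable_const.mul (measurable_id.pow_const _)).ennreal_ofReal
    -- the terms as integrals
    set G : (d → ℤ) → ℝ → ℝ≥0∞ := fun q s => S.indicator (fun q => (Ioi (fracSymbol 1 q)).indicator g s) q
      with hG
    have hGq : ∀ q, S.indicator (fun q => ENNReal.ofReal (fracSymbol (-t) q)) q = ∫⁻ s in Ioi (0 : ℝ), G q s := by
      intro q
      by_cases hq : q ∈ S
      · simp only [hG, indicator_of_mem hq]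
        have hμ : 0 < fracSymbol 1 q := fracSymbol_one_pos hq.1
        rw [lintegral_indicator measurableSet_Ioi, Measure.restrict_restrict measurableSet_Ioi,
          Ioi_inter_Ioi, sup_of_le_left hμ.le, hg, lintegral_Ioi_mul_rpow_neg ht0 hμ, fracSymbol_eq_rpow]
      · simp only [hG, indicator_of_notMem hq, lintegral_zero]
    have hGmeas : ∀ q, Measurable (G q) := by
      intro q
      by_cases hq : q ∈ S
      · simp only [hG, indicator_of_mem hq]
        exact hgm.indicator measurableSet_Ioi
      · simp only [hG, indicator_of_notMem hq]
        exact measurable_const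
    -- Tonelli
    have hT : ∑' q, ∫⁻ s in Ioi (0 : ℝ), G q s = ∫⁻ s in Ioi (0 : ℝ), ∑' q, G q s :=
      (lintegral_tsum fun q => (hGmeas q).aemeasurable).symm
    -- the integrand: counting at height `min c s`
    have hsum_s : ∀ s : ℝ, 0 < s → ∑' q, G q s ≤ g s * ENNReal.ofReal (K₀ * (min c s) ^ (3 / 2 : ℝ)) := by
      intro s hs
      have hpt : ∀ q, G q s ≤ g s * ({q : d → ℤ | q ≠ 0 ∧ fracSymbol 1 q ≤ min c s}).indicator
          (fun _ => (1 : ℝ≥0∞)) q := by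
        intro q
        by_cases hq : q ∈ S
        · simp only [hG, indicator_of_mem hq]
          by_cases hqs : s ∈ Ioi (fracSymbol 1 q)
          · rw [indicator_of_mem hqs, indicator_of_mem, mul_one]
            exact ⟨hq.1, le_min hq.2 (le_of_lt hqs)⟩
          · rw [indicator_of_notMem hqs]; exact zero_le
        · simp only [hG, indicator_of_notMem hq]; exact zero_le
      calc ∑' q, G q s ≤ ∑' q, g s * ({q : d → ℤ | q ≠ 0 ∧ fracSymbol 1 q ≤ min c s}).indicator
            (fun _ => (1 : ℝ≥0∞)) q := ENNReal.tsum_le_tsum hpt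
        _ = g s * ∑' q, ({q : d → ℤ | q ≠ 0 ∧ fracSymbol 1 q ≤ min c s}).indicator (fun _ => (1 : ℝ≥0∞)) q :=
            ENNReal.tsum_mul_left
        _ ≤ g s * ENNReal.ofReal (K₀ * (min c s) ^ (3 / 2 : ℝ)) :=
            mul_le_mul' le_rfl (hN (min c s) (lt_min hc hs))
    -- the two pieces
    have hpiece1 : ∀ s ∈ Ioc (0 : ℝ) c, g s * ENNReal.ofReal (K₀ * (min c s) ^ (3 / 2 : ℝ)) =
        ENNReal.ofReal (t * K₀) * ENNReal.ofReal (s ^ (1 / 2 - t)) := by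
      intro s hs
      have h1 : 0 ≤ t * s ^ (-t - 1) := mul_nonneg ht0.le (Real.rpow_nonneg hs.1.le _)
      have h2 : 0 ≤ t * K₀ := by positivity
      rw [min_eq_right hs.2, hg]
      show ENNReal.ofReal (t * s ^ (-t - 1)) * ENNReal.ofReal (K₀ * s ^ (3 / 2 : ℝ)) =
        ENNReal.ofReal (t * K₀) * ENNReal.ofReal (s ^ (1 / 2 - t))
      rw [← ENNReal.ofReal_mul h1, ← ENNReal.ofReal_mul h2]
      congr 1
      have e : s ^ (-t - 1) * s ^ (3 / 2 : ℝ) = s ^ (1 / 2 - t) := by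
        rw [← Real.rpow_add hs.1]; ring_nf
      calc t * s ^ (-t - 1) * (K₀ * s ^ (3 / 2 : ℝ)) = t * K₀ * (s ^ (-t - 1) * s ^ (3 / 2 : ℝ)) := by ring
        _ = t * K₀ * s ^ (1 / 2 - t) := by rw [e]
    have hpiece2 : ∀ s ∈ Ioi c, g s * ENNReal.ofReal (K₀ * (min c s) ^ (3 / 2 : ℝ)) =
        ENNReal.ofReal (K₀ * c ^ (3 / 2 : ℝ)) * g s := by
      intro s hs
      rw [min_eq_left (le_of_lt hs), mul_comm]
    have hI : ∫⁻ s in Ioi (0 : ℝ), ∑' q, G q s ≤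
        ENNReal.ofReal (K₀ * (t / (3 / 2 - t) + 1) * c ^ (3 / 2 - t)) := by
      calc ∫⁻ s in Ioi (0 : ℝ), ∑' q, G q s
          ≤ ∫⁻ s in Ioi (0 : ℝ), g s * ENNReal.ofReal (K₀ * (min c s) ^ (3 / 2 : ℝ)) :=
            setLIntegral_mono' measurableSet_Ioi fun s hs => hsum_s s hs
        _ = ∫⁻ s in Ioc (0 : ℝ) c ∪ Ioi c, g s * ENNReal.ofReal (K₀ * (min c s) ^ (3 / 2 : ℝ)) := by
            rw [Ioc_union_Ioi_eq_Ioi hc.le]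
        _ ≤ (∫⁻ s in Ioc (0 : ℝ) c, g s * ENNReal.ofReal (K₀ * (min c s) ^ (3 / 2 : ℝ))) +
              ∫⁻ s in Ioi c, g s * ENNReal.ofReal (K₀ * (min c s) ^ (3 / 2 : ℝ)) :=
            lintegral_union_le _ _ _
        _ = (∫⁻ s in Ioc (0 : ℝ) c, ENNReal.ofReal (t * K₀) * ENNReal.ofReal (s ^ (1 / 2 - t))) +
              ∫⁻ s in Ioi c, ENNReal.ofReal (K₀ * c ^ (3 / 2 : ℝ)) * g s := by
            rw [setLIntegral_congr_fun measurableSet_Ioc hpiece1,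
              setLIntegral_congr_fun measurableSet_Ioi hpiece2]
        _ = ENNReal.ofReal (t * K₀) * ENNReal.ofReal (c ^ (3 / 2 - t) / (3 / 2 - t)) +
              ENNReal.ofReal (K₀ * c ^ (3 / 2 : ℝ)) * ENNReal.ofReal (c ^ (-t)) := by
            rw [lintegral_const_mul' _ _ ENNReal.ofReal_ne_top, lintegral_const_mul' _ _ ENNReal.ofReal_ne_top,
              lintegral_Ioc_rpow_half_sub ht hc, hg, lintegral_Ioi_mul_rpow_neg ht0 hc]
        _ = ENNReal.ofReal (K₀ * (t / (3 / 2 - t) + 1) * c ^ (3 / 2 - t)) := by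
            rw [← ENNReal.ofReal_mul (by positivity), ← ENNReal.ofReal_mul (by positivity),
              ← ENNReal.ofReal_add (by positivity) (by positivity)]
            congr 1
            have e : c ^ (3 / 2 : ℝ) * c ^ (-t) = c ^ (3 / 2 - t) := by
              rw [← Real.rpow_add hc]; ring_nf
            calc t * K₀ * (c ^ (3 / 2 - t) / (3 / 2 - t)) + K₀ * c ^ (3 / 2 : ℝ) * c ^ (-t)
                = t * K₀ * (c ^ (3 / 2 - t) / (3 / 2 - t)) + K₀ * (c ^ (3 / 2 : ℝ) * c ^ (-t)) := by ring
              _ = t * K₀ * (c ^ (3 / 2 - t) / (3 / 2 - t)) + K₀ * c ^ (3 / 2 - t) := by rw [e]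
              _ = K₀ * (t / (3 / 2 - t) + 1) * c ^ (3 / 2 - t) := by
                  field_simp
    calc ∑' q, S.indicator (fun q => ENNReal.ofReal (fracSymbol (-t) q)) q
        = ∑' q, ∫⁻ s in Ioi (0 : ℝ), G q s := tsum_congr hGq
      _ = ∫⁻ s in Ioi (0 : ℝ), ∑' q, G q s := hT
      _ ≤ _ := hI

end LatticeTrilinear

end Summit.NavierStokesRegularity.FunctionalMining
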